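import Summits.ResolutionOfSingularities.ResolutionOfSingularities.Theses.DefectlessFrames

/-!
# Crux `ResidueTranscendenceReduction` (stmt-ResolutionOfSingularities-18875) — negative lemma: rebasing to a perfect intermediate field never lowers the residue dimension

Route `ResolutionOfSingularities/DefectlessFrames`, crux `ResidueTranscendenceReduction := ∀ p prime,
HypA p → ConcB p` (relative local uniformization at rank-one ZERO-DIMENSIONAL valuation rings over PERFECT
fields ⟹ at all valuation rings over perfect fields).  The dimension half classically rebases the ground
field to `k' = k(ξ) ⊆ O` (Zariski 1940 C.IV §9), over which `O` is zero-dimensional; `k(ξ)` is imperfect.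
This file proves the GENERAL obstruction behind the two typed witnesses of `Negative/NotPerfectRebase.lean`
and `Negative/NotPerfectRebaseRankOne.lean` (cdisprove seat, cycle 1):

* `isAlgebraic_of_perfectField_of_essFiniteType` — in characteristic `p`, a PERFECT intermediate field `k'`
  of a finitely generated field extension `K/k` is algebraic over `k` (any `k`, perfect or not).  Proof: a
  transcendental `u ∈ k'` sits in a transcendence basis `T` of `K/k`; `K/k(T)` is finite of some degree `N`;
  `k'` perfect gives `w ∈ k'` with `w^{pⁿ} = u` for `pⁿ > N`; the minimal polynomial of `w` over `k(T)` has
  separable degree one, hence is `X^{p^m} − y`; if `m < n` then `k(T)` contains a `p`-th root of the variable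
  `u` (impossible by a total-degree count in `k[T]`), and if `m ≥ n` then `[k(T)(w) : k(T)] = p^m > N`.
* `zeroDim_of_zeroDim_over_perfect` — consequently, for `(k, K, O)` in the range of the crux's conclusion
  (`K/k` finitely generated, `k ⊆ O`), if `O` is zero-dimensional over SOME perfect intermediate field
  `k' ⊆ O` then it is already zero-dimensional over `k`.  So no admissible (perfect) change of ground field
  inside `K` ever brings a positive-dimensional valuation ring into the range of `HypA`: the dimension half of
  the crux must leave the field `K` (auxiliary valued function field over a perfect transcendental extension
  of `k`, then inseparable descent — barrier `InseparableBaseChange`).  Full analysis: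
  `Cruxes/ResidueTranscendenceReduction/Disproof.lean`.
-/

set_option linter.dupNamespace false -- mandated namespace of this single-conjunct summit

open scoped Polynomial IntermediateField
open Polynomial

namespace Summit.ResolutionOfSingularities.ResolutionOfSingularities.Theorems.ResidueTranscendenceReduction.Negative

/-- Total degree of a power over a domain. [folklore] -/
theorem totalDegree_pow_of_isDomain {σ R : Type} [CommRing R] [IsDomain R] {f : MvPolynomial σ R}
    (hf : f ≠ 0) (n : ℕ) : (f ^ n).totalDegree = n * f.totalDegree := by
  induction n with
  | zero => simp
  | succ n ih =>
    rw [pow_succ, MvPolynomial.totalDegree_mul_of_isDomain (pow_ne_zero n hf) hf, ih]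
    ring

/-- A variable of `k[X_σ]` is not a `p`-th power in the rational function field `Frac k[X_σ]` (`p ≥ 2`):
total-degree count `p · deg a = 1 + p · deg b`. [folklore] -/
theorem pow_ne_X_fractionRing {k σ : Type} [Field k] (i : σ) {p : ℕ} (hp : 2 ≤ p)
    (z : FractionRing (MvPolynomial σ k)) :
    z ^ p ≠ algebraMap (MvPolynomial σ k) (FractionRing (MvPolynomial σ k)) (MvPolynomial.X i) := by
  intro hz
  obtain ⟨a, b, hb, rfl⟩ := IsFractionRing.div_surjective (A := MvPolynomial σ k) z
  have hb0 : b ≠ 0 := nonZeroDivisors.ne_zero hb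
  have hb' : algebraMap (MvPolynomial σ k) (FractionRing (MvPolynomial σ k)) b ≠ 0 :=
    IsFractionRing.to_map_ne_zero_of_mem_nonZeroDivisors hb
  rw [div_pow, div_eq_iff (pow_ne_zero _ hb'), ← map_pow, ← map_pow, ← map_mul,
    (IsFractionRing.injective (MvPolynomial σ k) (FractionRing (MvPolynomial σ k))).eq_iff] at hz
  -- hz : a ^ p = X i * b ^ p
  have ha0 : a ≠ 0 := by
    rintro rfl
    rw [zero_pow (by omega), eq_comm, mul_eq_zero] at hz
    rcases hz with h | h
    · exact MvPolynomial.X_ne_zero i h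
    · exact pow_ne_zero _ hb0 h
  have hdeg := congrArg MvPolynomial.totalDegree hz
  rw [totalDegree_pow_of_isDomain ha0,
    MvPolynomial.totalDegree_mul_of_isDomain (MvPolynomial.X_ne_zero i) (pow_ne_zero _ hb0),
    totalDegree_pow_of_isDomain hb0, MvPolynomial.totalDegree_X] at hdeg
  have h2 : p ∣ 1 + p * b.totalDegree := hdeg ▸ dvd_mul_right p a.totalDegree
  have h3 : p ∣ 1 := (Nat.dvd_add_left (dvd_mul_right p b.totalDegree)).mp h2
  have := Nat.le_of_dvd one_pos h3
  omega

/-- An element of an algebraically independent family is not a `p`-th power in the field it generates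
(`p ≥ 2`). [folklore] -/
theorem pow_ne_of_algebraicIndependent {k K ι : Type} [Field k] [Field K] [Algebra k K] {x : ι → K}
    (hx : AlgebraicIndependent k x) (i : ι) {p : ℕ} (hp : 2 ≤ p)
    (v : IntermediateField.adjoin k (Set.range x)) : (v : K) ^ p ≠ x i := by
  intro hv
  apply pow_ne_X_fractionRing i hp (hx.aevalEquivField.symm v)
  apply hx.aevalEquivField.injective
  apply Subtype.ext
  rw [map_pow, AlgEquiv.apply_symm_apply, hx.aevalEquivField_algebraMap_apply_coe, MvPolynomial.aeval_X]
  push_cast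
  exact hv

/-- **A perfect intermediate field of a finitely generated extension is algebraic over the base**
(characteristic `p`; the base need not be perfect). [folklore] -/
theorem isAlgebraic_of_perfectField_of_essFiniteType {k K : Type} [Field k] [Field K] [Algebra k K]
    (p : ℕ) [hp : Fact p.Prime] [CharP k p] [Algebra.EssFiniteType k K]
    (k' : IntermediateField k K) [PerfectField k'] : Algebra.IsAlgebraic k k' := by
  classical
  haveI : CharP K p := charP_of_injective_algebraMap (algebraMap k K).injective p
  haveI : CharP k' p := ((algebraMap k' K).charP_iff_charP p).mpr inferInstance
  haveI : ExpChar k' p := ExpChar.prime hp.out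
  haveI : PerfectRing k' p := PerfectField.toPerfectRing p
  rw [Algebra.isAlgebraic_def]
  by_contra hnot
  obtain ⟨u, hu⟩ := not_forall.mp hnot
  have huK : Transcendental k (u : K) :=
    (transcendental_algebraMap_iff (algebraMap k' K).injective).mpr hu
  -- a transcendence basis of `K/k` through `u`
  have hind : AlgebraicIndepOn k id ({(u : K)} : Set K) :=
    (algebraicIndependent_singleton_iff (⟨(u : K), Set.mem_singleton _⟩ : ({(u : K)} : Set K))).mpr huK
  obtain ⟨T, huT, hT⟩ := exists_isTranscendenceBasis_superset hind
  have huT' : (u : K) ∈ T := huT (Set.mem_singleton _)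
  set F : IntermediateField k K := IntermediateField.adjoin k (Set.range ((↑) : T → K)) with hF
  haveI : Algebra.IsAlgebraic F K := hT.isAlgebraic_field
  haveI : Algebra.EssFiniteType F K := Algebra.EssFiniteType.of_comp k F K
  haveI : Module.Finite F K := Algebra.finite_of_essFiniteType_of_isAlgebraic (F := F) (E := K)
  haveI : CharP F p := ((algebraMap F K).charP_iff_charP p).mpr inferInstance
  haveI : ExpChar F p := ExpChar.prime hp.out
  have huF : (u : K) ∈ F := IntermediateField.subset_adjoin k _ ⟨⟨(u : K), huT'⟩, rfl⟩
  -- `pⁿ > [K : F]` and a `pⁿ`-th root `w ∈ k'` of `u`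
  obtain ⟨n, hn⟩ : ∃ n : ℕ, Module.finrank F K < p ^ n := ⟨_, Nat.lt_pow_self hp.out.one_lt⟩
  obtain ⟨w, hw⟩ := (iterateFrobeniusEquiv k' p n).surjective u
  have hwK : ((w : k') : K) ^ p ^ n = (u : K) := by
    rw [← hw, coe_iterateFrobeniusEquiv, iterateFrobenius_def]
    push_cast
    rfl
  -- the minimal polynomial of `w` over `F` is `X^{p^m} − y`
  have hsep : (minpoly F ((w : k') : K)).natSepDegree = 1 :=
    (minpoly.natSepDegree_eq_one_iff_pow_mem p).mpr ⟨n, ⟨⟨(u : K), huF⟩, hwK.symm⟩⟩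
  obtain ⟨m, y, hmin⟩ := (minpoly.natSepDegree_eq_one_iff_eq_X_pow_sub_C p).mp hsep
  have hwm : ((w : k') : K) ^ p ^ m = algebraMap F K y := by
    have h0 := minpoly.aeval F ((w : k') : K)
    rw [hmin] at h0
    simpa [sub_eq_zero] using h0
  by_cases hmn : m < n
  · -- then `F = k(T)` contains a `p`-th root of the variable `u`
    have hroot : ((y ^ p ^ (n - m - 1) : F) : K) ^ p = (u : K) := by
      push_cast
      rw [show ((y : F) : K) = algebraMap F K y from rfl, ← hwm, ← pow_mul, ← pow_mul, ← hwK]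
      congr 1
      rw [← pow_succ, ← pow_add]
      congr 1
      omega
    exact pow_ne_of_algebraicIndependent hT.1 ⟨(u : K), huT'⟩ hp.out.two_le _ hroot
  · -- otherwise the degree of `w` over `F` exceeds `[K : F]`
    have hdeg : (minpoly F ((w : k') : K)).natDegree = p ^ m := by
      rw [hmin, natDegree_X_pow_sub_C]
    have hle := minpoly.natDegree_le (A := F) ((w : k') : K)
    have hpow : p ^ n ≤ p ^ m := Nat.pow_le_pow_right hp.out.pos (not_lt.mp hmn)
    omega

/-- **Rebasing to a perfect intermediate field never lowers the residue dimension.** For a finitely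
generated extension `K/k` in characteristic `p` and a valuation ring `O` of `K` containing `k`: if `O` is
zero-dimensional over some PERFECT intermediate field `k' ⊆ O` (every `x ∈ O` satisfies `f(x) ∈ 𝔪_O` for a
non-zero `f ∈ k'[X]`), then `O` is already zero-dimensional over `k`.  Hence the hypothesis `HypA` of
`ResidueTranscendenceReduction` is applicable to `(k', K, O)` for some admissible `k'` only when it is
applicable to `(k, K, O)` itself (given rank one): the dimension half cannot be reached inside `K`. [folklore] -/
theorem zeroDim_of_zeroDim_over_perfect {k K : Type} [Field k] [Field K] [Algebra k K]
    (p : ℕ) [hp : Fact p.Prime] [CharP k p] (hfg : (⊤ : IntermediateField k K).FG)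
    (O : ValuationSubring K) (k' : IntermediateField k K) (hk' : ∀ c : k', (c : K) ∈ O) [PerfectField k']
    (hzd : ∀ x ∈ O, ∃ f : Polynomial k', f ≠ 0 ∧ Polynomial.aeval x f ∈ O.nonunits) :
    ∀ x ∈ O, ∃ f : Polynomial k, f ≠ 0 ∧ Polynomial.aeval x f ∈ O.nonunits := by
  classical
  haveI : Algebra.EssFiniteType k K := IntermediateField.fg_top_iff.mp hfg
  haveI : Algebra.IsAlgebraic k k' := isAlgebraic_of_perfectField_of_essFiniteType p k'
  intro x hx
  obtain ⟨f, hf0, hf⟩ := hzd x hx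
  -- work in the residue field: `x̄` is a root of `f̄ ≠ 0`, whose coefficients are algebraic over `k`
  let φ : k' →+* O := (algebraMap k' K).codRestrict O (fun c => hk' c)
  let κ := IsLocalRing.ResidueField O
  let ψ : k' →+* κ := (IsLocalRing.residue O).comp φ
  -- `k → O → κ`
  have hk : ∀ c : k, algebraMap k K c ∈ O := fun c => by
    simpa using hk' (algebraMap k k' c)
  let φ₀ : k →+* O := (algebraMap k K).codRestrict O hk
  let ψ₀ : k →+* κ := (IsLocalRing.residue O).comp φ₀
  letI : Algebra k κ := ψ₀.toAlgebra
  letI : Algebra k' κ := ψ.toAlgebra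
  haveI : IsScalarTower k k' κ := IsScalarTower.of_algebraMap_eq fun c => rfl
  let xO : O := ⟨x, hx⟩
  let xbar : κ := IsLocalRing.residue O xO
  -- `x̄` algebraic over `k'`
  have hcoe : ((Polynomial.eval₂ φ xO f : O) : K) = Polynomial.aeval x f := by
    rw [show ((Polynomial.eval₂ φ xO f : O) : K) = O.subtype (Polynomial.eval₂ φ xO f) from rfl,
      Polynomial.hom_eval₂, Polynomial.aeval_def]
    rfl
  have hroot : Polynomial.aeval xbar f = 0 := by
    rw [Polynomial.aeval_def, show algebraMap k' κ = ψ from rfl]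
    have h1 : Polynomial.eval₂ ψ xbar f = IsLocalRing.residue O (Polynomial.eval₂ φ xO f) := by
      rw [Polynomial.hom_eval₂]
    rw [h1, IsLocalRing.residue_eq_zero_iff, ValuationSubring.valuation_lt_one_iff, hcoe,
      ← ValuationSubring.mem_nonunits_iff]
    exact hf
  have halg' : IsAlgebraic k' xbar := ⟨f, hf0, hroot⟩
  -- hence algebraic over `k`
  have halg : IsAlgebraic k xbar := IsAlgebraic.restrictScalars k halg'
  obtain ⟨g, hg0, hg⟩ := halg
  refine ⟨g, hg0, ?_⟩
  -- pull `g(x̄) = 0` back to `g(x) ∈ 𝔪_O`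
  have hcoe0 : ((Polynomial.eval₂ φ₀ xO g : O) : K) = Polynomial.aeval x g := by
    rw [show ((Polynomial.eval₂ φ₀ xO g : O) : K) = O.subtype (Polynomial.eval₂ φ₀ xO g) from rfl,
      Polynomial.hom_eval₂, Polynomial.aeval_def]
    rfl
  rw [Polynomial.aeval_def, show algebraMap k κ = ψ₀ from rfl] at hg
  have h1 : Polynomial.eval₂ ψ₀ xbar g = IsLocalRing.residue O (Polynomial.eval₂ φ₀ xO g) := by
    rw [Polynomial.hom_eval₂]
  rw [h1, IsLocalRing.residue_eq_zero_iff, ValuationSubring.valuation_lt_one_iff, hcoe0,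
    ← ValuationSubring.mem_nonunits_iff] at hg
  exact hg

end Summit.ResolutionOfSingularities.ResolutionOfSingularities.Theorems.ResidueTranscendenceReduction.Negative
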